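import Mathlib
import HarnessLib
import Literature.Analysis.FluidPDE.SuitableWeak
import Literature.Analysis.FluidPDE.LerayHopf
import Literature.Analysis.FluidPDE.ClassicalSolution
import Literature.Analysis.FluidPDE.NSViscosityRescaling
import Literature.Analysis.FluidPDE.NSLerayHopfABCScaling
import Summits.NavierStokesRegularity.NavierStokesRegularity.Theorems.QuarterJoltJoltFlatCell
import Summits.NavierStokesRegularity.NavierStokesRegularity.Theorems.QuarterJoltNoFlatCellVertex

/-!
# Route QuarterJolt — crux `NoTerminalJolt` (stmt-NavierStokesRegularity-26463), LEAD line
# `regular_split`: the two supports under the plain TYPE-I RATE (no slice law)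

Seat ns-ntj-p1 g2 (LEAD of the crux; `--supports 26463 --as helper`). First of two files
(`QuarterJoltTypeIFlatCell`, `QuarterJoltTypeIJoltLaw`).

OBSERVATION (read off the landed proofs `JoltFlatCell.main`, p615390, and `NoFlatCellVertex.main`,
p616987): both route supports use the quarter slice law `∫|curl u(t)|² ≤ K/√(T−t)` ONLY through the
velocity Type-I rate it implies (`RecordTimeTypeI.main`, item 22145). This file re-runs the two landed
proofs verbatim with that rate — `IsTypeIBlowup u T : ∃ C, ∀ᶠ t ↑ T, ∀ x, ‖u t x‖ ≤ C/√(T−t)` — as the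
HYPOTHESIS in place of the slice law:

* `JoltFlatCell.main_of_isTypeIBlowup` — Leray–Hopf on `[0,T]` + Type-I rate at `T` + no terminal
  jolt `(√(T−t))⁻¹∫‖u(t)−u(T)‖² → 0` ⇒ at EVERY `x₀` the scaled cell energy vanishes
  (`∀ ε > 0 ∃ r₀ > 0 ∀ r ∈ (0,r₀) ∀ t ∈ (T−r²,T]: ∫_{B_r(x₀)}|u(t)|² ≤ ε r`); two triangle inequalities
  through `u(T)` (the classical-solution and decay hypotheses are not even needed here);
* `NoFlatCellVertex.main_of_isTypeIBlowup` — classical on `[0,T)`, Leray–Hopf on `[0,T]`, Type-I rate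
  at `T`, vanishing scaled cell energy at `x₀` ⇒ `(T, x₀)` is not a singular vertex; `C(r) ≤ 2Cε → 0`
  from `|u|³ ≤ |u|²·C/√(T−t)` (`tendsto_cknC_of_typeI_of_flat`), ν-normalisation, and the unit-viscosity
  ε-regularity core `NoFlatCellVertex.core` (Seregin–Šverák gauge, pressure-decay iteration,
  Robinson–Rodrigo–Sadowski Thm. 15.3) — all landed.

USE (second file): the TYPE-I TERMINAL JOLT LAW — every Type-I first blow-up in the frame jolts — and
the typed edges `NoTerminalJolt ⇒ NoTypeIBlowup` (item 1217) and `NoTypeII (item 0056) ∧ NoTerminalJolt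
⇒ Clay (A)`.

HONEST FRAMING: statements about HYPOTHETICAL Type-I blow-ups; nothing here proves `NoTerminalJolt`
(stmt-26463), `EnstrophyQuarterLaw` (stmt-1574), `NoTypeIBlowup` (stmt-1217) or Navier–Stokes
regularity — all OPEN. No summit statement is proved here. Proofs adapted from
`QuarterJoltJoltFlatCell.lean` / `QuarterJoltNoFlatCellVertex.lean` (ns-qj-p1 g0), step 1 replaced by
the hypothesis. [folklore]
-/

noncomputable section

-- the summit and its single sub-problem share the name (CONVENTIONS §1), as in every Theorems file
set_option linter.dupNamespace false

namespace Summit.NavierStokesRegularity.NavierStokesRegularity.Theorems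

open MeasureTheory Set Function Filter Topology Metric
open scoped NNReal ENNReal
open Literature.Analysis.FluidPDE

namespace JoltFlatCell

/-- **JoltFlatCell under the plain Type-I rate.** If `u` is Leray–Hopf on `[0,T]` (so every slice
`u(t)`, `t ∈ [0,T]`, is in `L²` and `u(T)` is the Leray–Hopf terminal value), obeys the Type-I rate
`‖u(t,x)‖ ≤ C/√(T−t)` for `t < T` near `T`, and has no terminal jolt
(`(√(T−t))⁻¹∫‖u(t)−u(T)‖² → 0` as `t ↑ T`), then at every `x₀` the scaled cell energy vanishes:
`∀ ε > 0 ∃ r₀ > 0 ∀ r ∈ (0,r₀) ∀ t ∈ (T−r², T]: ∫_{B_r(x₀)}|u(t)|² ≤ ε r`. Same proof as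
`JoltFlatCell.main` (two triangle inequalities through `u(T)`, the Type-I bound at the one earlier
time `T − θr²`). [folklore] -/
theorem main_of_isTypeIBlowup {ν T : ℝ} (hT : 0 < T)
    {u : ℝ → EuclideanSpace ℝ (Fin 3) → EuclideanSpace ℝ (Fin 3)}
    (hLH : IsLerayHopfOn T ν 0 (u 0) u) (hTI : IsTypeIBlowup u T)
    (hJ : Tendsto (fun t : ℝ => (Real.sqrt (T - t))⁻¹ * ∫ x, ‖u t x - u T x‖ ^ 2) (𝓝[<] T) (𝓝 0))
    (x₀ : EuclideanSpace ℝ (Fin 3)) {ε : ℝ} (hε : 0 < ε) :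
    ∃ r₀ : ℝ, 0 < r₀ ∧ ∀ r : ℝ, 0 < r → r < r₀ → ∀ t ∈ Ioc (T - r ^ 2) T,
      ∫⁻ x in ball x₀ r, ‖u t x‖ₑ ^ 2 ≤ ENNReal.ofReal (ε * r) := by
  -- Step 1: the velocity Type-I rate is now the HYPOTHESIS `hTI`
  obtain ⟨C, hC⟩ := hTI
  -- the volume of the unit ball as a real number
  obtain ⟨V, hV0, hV⟩ : ∃ V : ℝ, 0 ≤ V ∧ volume (ball (0 : EuclideanSpace ℝ (Fin 3)) 1) = ENNReal.ofReal V :=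
    ⟨_, ENNReal.toReal_nonneg, (ENNReal.ofReal_toReal measure_ball_lt_top.ne).symm⟩
  -- the depth parameter `θ` and the jolt threshold `δ`
  obtain ⟨θ, hθ1, hθε⟩ : ∃ θ : ℝ, 1 ≤ θ ∧ 4 * C ^ 2 * V / θ ≤ ε / 4 := by
    refine ⟨max 1 (16 * C ^ 2 * V / ε), le_max_left _ _, ?_⟩
    have hθ0 : 0 < max 1 (16 * C ^ 2 * V / ε) := lt_of_lt_of_le one_pos (le_max_left _ _)
    have h' : 16 * C ^ 2 * V ≤ max 1 (16 * C ^ 2 * V / ε) * ε := (div_le_iff₀ hε).1 (le_max_right _ _)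
    rw [div_le_iff₀ hθ0]
    linarith
  have hθ0 : 0 < θ := by linarith
  have hsθ : 1 ≤ Real.sqrt θ := Real.one_le_sqrt.2 hθ1
  have hsθ0 : 0 < Real.sqrt θ := by linarith
  -- the Type-I cell constant `W = C²|B₁|/θ`
  obtain ⟨W, hW0, hWε, hWdef⟩ : ∃ W : ℝ, 0 ≤ W ∧ 4 * W ≤ ε / 4 ∧ W = C ^ 2 * V / θ :=
    ⟨C ^ 2 * V / θ, by positivity, by
      have h : 4 * (C ^ 2 * V / θ) = 4 * C ^ 2 * V / θ := by ring
      rw [h]; exact hθε, rfl⟩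
  obtain ⟨δ, hδ0, hδ1, hδ2⟩ : ∃ δ : ℝ, 0 < δ ∧ 4 * δ * Real.sqrt θ = ε / 4 ∧ 2 * δ ≤ ε / 8 := by
    refine ⟨ε / (16 * Real.sqrt θ), by positivity, ?_, ?_⟩
    · field_simp
      ring
    · have h : 2 * (ε / (16 * Real.sqrt θ)) = ε / (8 * Real.sqrt θ) := by
        field_simp
        ring
      rw [h]
      exact div_le_div_of_nonneg_left hε.le (by norm_num) (by linarith)
  -- Step 2: the window `(T₁, T)` on which the Type-I bound and `D < δ` hold
  have h2 : ∀ᶠ t in 𝓝[<] T, (Real.sqrt (T - t))⁻¹ * ∫ x, ‖u t x - u T x‖ ^ 2 < δ :=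
    hJ.eventually (Iio_mem_nhds hδ0)
  have h3 : ∀ᶠ t in 𝓝[<] T, t ∈ Ioo 0 T := Ioo_mem_nhdsLT hT
  obtain ⟨T₁, hT₁T, hT₁⟩ := mem_nhdsLT_iff_exists_Ioo_subset.1 (hC.and (h2.and h3))
  have hT₁T' : T₁ < T := hT₁T
  -- the radius
  refine ⟨Real.sqrt ((T - T₁) / θ), Real.sqrt_pos.2 (div_pos (sub_pos.2 hT₁T') hθ0), ?_⟩
  intro r hr hrr₀ t ht
  have hθr : θ * r ^ 2 < T - T₁ := by
    have h := pow_lt_pow_left₀ hrr₀ hr.le two_ne_zero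
    rw [Real.sq_sqrt (div_pos (sub_pos.2 hT₁T') hθ0).le, lt_div_iff₀ hθ0] at h
    linarith
  -- the earlier time `s = T - θ r²`
  set s : ℝ := T - θ * r ^ 2 with hs
  have hr2 : 0 < θ * r ^ 2 := by positivity
  have hsI : s ∈ Ioo T₁ T := ⟨by rw [hs]; linarith, by rw [hs]; linarith⟩
  obtain ⟨hCs, hDs, hs0T⟩ := hT₁ hsI
  have hTs : T - s = θ * r ^ 2 := by rw [hs]; ring
  have hsqTs : Real.sqrt (T - s) = Real.sqrt θ * r := by
    rw [hTs, Real.sqrt_mul hθ0.le, Real.sqrt_sq hr.le]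
  have hsq0 : 0 < Real.sqrt (T - s) := by rw [hsqTs]; positivity
  have hmT : MemLp (u T) 2 volume := hLH.memLp T ⟨hT.le, le_rfl⟩
  have hms : MemLp (u s) 2 volume := hLH.memLp s ⟨hs0T.1.le, hs0T.2.le⟩
  -- (a) the Type-I cell bound at time `s`
  have hA : ∫⁻ x in ball x₀ r, ‖u s x‖ₑ ^ 2 ≤ ENNReal.ofReal (C ^ 2 / (θ * r ^ 2) * r ^ 3 * V) := by
    refine setLIntegral_ball_le_of_bound hr (by positivity) hV fun x => ?_
    have hx := hCs x
    calc ‖u s x‖ ^ 2 ≤ (C / Real.sqrt (T - s)) ^ 2 := pow_le_pow_left₀ (norm_nonneg _) hx 2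
      _ = C ^ 2 / (θ * r ^ 2) := by rw [div_pow, Real.sq_sqrt (by rw [hTs]; positivity), hTs]
  -- (b) the jolt bound at time `s`: `‖u(T) − u(s)‖₂² ≤ δ √θ r`
  have hI_s : ∫ x, ‖u T x - u s x‖ ^ 2 ≤ δ * (Real.sqrt θ * r) := by
    have h := mul_lt_mul_of_pos_left hDs hsq0
    rw [← mul_assoc, mul_inv_cancel₀ hsq0.ne', one_mul, hsqTs] at h
    have h' : (∫ x, ‖u T x - u s x‖ ^ 2) = ∫ x, ‖u s x - u T x‖ ^ 2 := by
      simp_rw [norm_sub_rev (u T _) (u s _)]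
    rw [h', mul_comm (Real.sqrt θ * r) δ] at *
    exact h.le
  have hL_s : ∫⁻ x, ‖u T x - u s x‖ₑ ^ 2 ≤ ENNReal.ofReal (δ * (Real.sqrt θ * r)) := by
    rw [lintegral_enorm_sq_eq_ofReal (f := fun x => u T x - u s x) (hmT.sub hms)]
    exact ENNReal.ofReal_le_ofReal hI_s
  -- (c) the cell energy at the terminal time
  have hB : ∫⁻ x in ball x₀ r, ‖u T x‖ₑ ^ 2 ≤ ENNReal.ofReal ((2 * δ * Real.sqrt θ + 2 * W) * r) := by
    calc ∫⁻ x in ball x₀ r, ‖u T x‖ₑ ^ 2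
        ≤ 2 * (∫⁻ x in ball x₀ r, ‖u T x - u s x‖ₑ ^ 2) + 2 * ∫⁻ x in ball x₀ r, ‖u s x‖ₑ ^ 2 :=
          setLIntegral_enorm_sq_le hms.1 _
      _ ≤ 2 * ENNReal.ofReal (δ * (Real.sqrt θ * r)) + 2 * ENNReal.ofReal (C ^ 2 / (θ * r ^ 2) * r ^ 3 * V) :=
          add_le_add (mul_le_mul_right ((setLIntegral_le_lintegral _ _).trans hL_s) 2)
            (mul_le_mul_right hA 2)
      _ = ENNReal.ofReal (2 * (δ * (Real.sqrt θ * r)) + 2 * (C ^ 2 / (θ * r ^ 2) * r ^ 3 * V)) :=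
          two_mul_ofReal_add (by positivity) (by positivity)
      _ = ENNReal.ofReal ((2 * δ * Real.sqrt θ + 2 * W) * r) := by
          congr 1
          rw [hWdef]
          field_simp
  have hAε : 2 * δ * Real.sqrt θ + 2 * W ≤ ε / 4 := by linarith
  -- (d) the two cases `t = T` and `t < T`
  rcases ht.2.eq_or_lt with rfl | htT
  · calc ∫⁻ x in ball x₀ r, ‖u t x‖ₑ ^ 2 ≤ ENNReal.ofReal ((2 * δ * Real.sqrt θ + 2 * W) * r) := hB
      _ ≤ ENNReal.ofReal (ε * r) :=
          ENNReal.ofReal_le_ofReal (mul_le_mul_of_nonneg_right (by linarith) hr.le)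
  · have ht₁ : T₁ < t := by
      have : T - θ * r ^ 2 ≤ T - r ^ 2 := by nlinarith [sq_nonneg r]
      linarith [ht.1, hsI.1]
    obtain ⟨-, hDt, ht0T⟩ := hT₁ ⟨ht₁, htT⟩
    have hmt : MemLp (u t) 2 volume := hLH.memLp t ⟨ht0T.1.le, ht0T.2.le⟩
    have hTt : 0 < T - t := sub_pos.2 htT
    have hsqt : Real.sqrt (T - t) < r := by
      calc Real.sqrt (T - t) < Real.sqrt (r ^ 2) := Real.sqrt_lt_sqrt hTt.le (by linarith [ht.1])
        _ = r := Real.sqrt_sq hr.le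
    have hsqt0 : 0 < Real.sqrt (T - t) := Real.sqrt_pos.2 hTt
    have hI_t : ∫ x, ‖u t x - u T x‖ ^ 2 ≤ δ * r := by
      have h := mul_lt_mul_of_pos_left hDt hsqt0
      rw [← mul_assoc, mul_inv_cancel₀ hsqt0.ne', one_mul] at h
      have h' : Real.sqrt (T - t) * δ ≤ r * δ := mul_le_mul_of_nonneg_right hsqt.le hδ0.le
      linarith
    have hL_t : ∫⁻ x, ‖u t x - u T x‖ₑ ^ 2 ≤ ENNReal.ofReal (δ * r) := by
      rw [lintegral_enorm_sq_eq_ofReal (f := fun x => u t x - u T x) (hmt.sub hmT)]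
      exact ENNReal.ofReal_le_ofReal hI_t
    have hsum : 2 * δ + 2 * (2 * δ * Real.sqrt θ + 2 * W) ≤ ε := by linarith
    calc ∫⁻ x in ball x₀ r, ‖u t x‖ₑ ^ 2
        ≤ 2 * (∫⁻ x in ball x₀ r, ‖u t x - u T x‖ₑ ^ 2) + 2 * ∫⁻ x in ball x₀ r, ‖u T x‖ₑ ^ 2 :=
          setLIntegral_enorm_sq_le hmT.1 _
      _ ≤ 2 * ENNReal.ofReal (δ * r) + 2 * ENNReal.ofReal ((2 * δ * Real.sqrt θ + 2 * W) * r) :=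
          add_le_add (mul_le_mul_right ((setLIntegral_le_lintegral _ _).trans hL_t) 2)
            (mul_le_mul_right hB 2)
      _ = ENNReal.ofReal (2 * (δ * r) + 2 * ((2 * δ * Real.sqrt θ + 2 * W) * r)) :=
          two_mul_ofReal_add (by positivity) (by positivity)
      _ ≤ ENNReal.ofReal (ε * r) := by
          refine ENNReal.ofReal_le_ofReal ?_
          calc 2 * (δ * r) + 2 * ((2 * δ * Real.sqrt θ + 2 * W) * r)
              = (2 * δ + 2 * (2 * δ * Real.sqrt θ + 2 * W)) * r := by ring
            _ ≤ ε * r := mul_le_mul_of_nonneg_right hsum hr.le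

end JoltFlatCell

namespace NoFlatCellVertex

/-- **NoFlatCellVertex under the plain Type-I rate.** In the frame with viscosity `ν` (classical on
`[0,T)`, Leray–Hopf on `[0,T]`), the Type-I rate at `T` and a vanishing scaled cell energy at `x₀` are
incompatible with `(T, x₀)` being a singular vertex. Same proof as `NoFlatCellVertex.main` from its
step 2 on (`C(r) → 0` by `tendsto_cknC_of_typeI_of_flat`, ν-normalisation, `NoFlatCellVertex.core`).
[folklore] -/
theorem main_of_isTypeIBlowup {ν T : ℝ} (hν : 0 < ν) (hT : 0 < T)
    {u : ℝ → EuclideanSpace ℝ (Fin 3) → EuclideanSpace ℝ (Fin 3)} {p : ℝ → EuclideanSpace ℝ (Fin 3) → ℝ}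
    (hsol : IsClassicalNSSolutionOn (Ico 0 T) ν 0 u p) (hLH : IsLerayHopfOn T ν 0 (u 0) u)
    (hTI : IsTypeIBlowup u T)
    (x₀ : EuclideanSpace ℝ (Fin 3))
    (hflat : ∀ ε : ℝ, 0 < ε → ∃ r₀ : ℝ, 0 < r₀ ∧ ∀ r : ℝ, 0 < r → r < r₀ →
      ∀ t ∈ Ioc (T - r ^ 2) T, ∫⁻ x in ball x₀ r, ‖u t x‖ₑ ^ 2 ≤ ENNReal.ofReal (ε * r))
    (hsing : ∀ r : ℝ, 0 < r → r ^ 2 < T →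
      eLpNorm (uncurry u) ⊤
        (volume.restrict (parabolicCylinder r ((T : ℝ), x₀))) = ⊤) : False := by
  -- Step 1: the Type-I window is now the HYPOTHESIS `hTI`
  obtain ⟨C, hC⟩ := hTI
  obtain ⟨T₁, hT₁T, hT₁⟩ := mem_nhdsLT_iff_exists_Ioo_subset.1 hC
  have hT₁T' : T₁ < T := hT₁T
  have hI : ∀ t ∈ Ioo T₁ T, ∀ x, ‖u t x‖ ≤ C / Real.sqrt (T - t) := fun t ht => hT₁ ht
  have hC0 : 0 ≤ C := by
    obtain ⟨t, ht⟩ := nonempty_Ioo.2 hT₁T'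
    have h := hI t ht x₀
    have hsq : 0 < Real.sqrt (T - t) := Real.sqrt_pos.2 (sub_pos.2 ht.2)
    by_contra hneg
    rw [not_le] at hneg
    have : C / Real.sqrt (T - t) < 0 := div_neg_of_neg_of_pos hneg hsq
    linarith [norm_nonneg (u t x₀)]
  -- Step 3: the ν-normalisation
  have hνT : 0 < ν * T := mul_pos hν hT
  have hsol' : IsClassicalNSSolutionOn (Ico 0 (ν * T)) 1 0 (timeRescale ν⁻¹ ν⁻¹ u)
      (timeRescale ν⁻¹ (ν⁻¹ ^ 2) p) := by
    have hmaps : MapsTo (fun τ => ν⁻¹ * τ) (Ico 0 (ν * T)) (Ico 0 T) := by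
      intro τ hτ
      refine ⟨by have := hτ.1; positivity, ?_⟩
      rw [inv_mul_lt_iff₀ hν]
      exact hτ.2
    have h := hsol.viscosityRescale_set hν.ne' hmaps (uniqueDiffOn_Ico 0 (ν * T))
    rwa [timeRescale_zero_force] at h
  have hLH' : IsLerayHopfOn (ν * T) 1 0 (timeRescale ν⁻¹ ν⁻¹ u 0) (timeRescale ν⁻¹ ν⁻¹ u) := by
    have h := hLH.viscosityRescale (c := ν⁻¹) (inv_pos.2 hν)
    have e1 : T / ν⁻¹ = ν * T := by rw [div_inv_eq_mul, mul_comm]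
    have e2 : ν⁻¹ * ν = 1 := inv_mul_cancel₀ hν.ne'
    have e3 : timeRescale ν⁻¹ (ν⁻¹ ^ 2)
        (0 : ℝ → (EuclideanSpace ℝ (Fin 3)) → (EuclideanSpace ℝ (Fin 3))) = 0 :=
      timeRescale_zero_force _ _
    have e4 : ν⁻¹ • u 0 = timeRescale ν⁻¹ ν⁻¹ u 0 := by
      funext x
      rw [timeRescale_apply, mul_zero, Pi.smul_apply]
    rw [e1, e2, e3, e4] at h
    exact h
  have hI' := typeI_timeRescale hν hI
  have hflat' := flat_timeRescale hν (T := T) hflat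
  -- Step 4 at unit viscosity, and the contradiction with the transported singular vertex
  obtain ⟨ρ, hρ, hρT, hfin⟩ := core hνT hsol' hLH' (mul_lt_mul_of_pos_left hT₁T' hν)
    (by positivity : 0 ≤ C / Real.sqrt ν) hI' hflat'
  exact hfin.ne (singular_timeRescale hν hsing hρ hρT)

end NoFlatCellVertex

end Summit.NavierStokesRegularity.NavierStokesRegularity.Theorems

end
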